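import Summits.AtomisticToContinuum.Crystallization.Theorems.PerronTransitivityUniformBindingRigidityCohesionN

/-!
# Cohesion of uniformly bound Lennard-Jones configurations, XVI: the reduction at any separation

Helper file (`--supports stmt-AtomisticToContinuum-15099`) of the registered stub
`stub_localHalfSpaceCert` (= `(LOCAL)`) of the line `registered` of the crux
`Summit.AtomisticToContinuum.Crystallization.Theses.PerronTransitivity.UniformBindingRigidity`
(item stmt-AtomisticToContinuum-15099).  Parts XII/XIV reduce `(LOCAL)` — posed at separation
`9/20`, constraint radius `6`, level `−711/500` — to a finite certificate; part XV shows that the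
competitors of `(LOCAL)` are in fact `23/40`-separated (`stub_local_sepSharp`), inviting a reshape.
So the reduction is recorded here once and for all with the separation `δ > 0`, the constraint
radius `r ≥ 0`, the level `Λ` and the truncation radius `R' > 0` as PARAMETERS:

* §29 `local_of_finiteCert_of_tail_at` (abstract tail allowance `τ`) and the registered
  `stub_local_of_finiteCert_at`: with the sharp allowance `T(δ, R')/6` of part XIV,

    `FINCERT(δ, r, Λ, R')`: every finite `δ`-separated `F ∋ 0` in `{⟪·, u⟫ ≤ 0} ∩ closedBall 0 (r + R')`
    (`‖u‖ = 1`) has a site `p`, `dist p 0 ≤ r`, with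
    `Λ + T(δ, R')/6 < Σ_{q ∈ F, q ≠ p, dist q p ≤ R'} V_LJ(dist p q)`

  implies `LOCAL(δ, r, Λ)`: no `δ`-separated `Y ∋ 0` in a closed half-space through `0` has all its
  sites within `r` of `0` bound `≤ Λ`;
* the instance `local_sharpSep_of_finiteCert` at `(δ, r, Λ) = (23/40, 6, −711/500)`, i.e. the
  reduction of the reshaped `(LOCAL♯)`; by `stub_local_sepSharp`, `(LOCAL♯)` and `(SEP)` still give
  the half-space core `(CORE)` (`halfSpaceCore_of_localSharp`).

All `[folklore]`.
-/

noncomputable section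

namespace Summit.AtomisticToContinuum.Crystallization.Theorems.PerronTransitivityUniformBindingRigidity

open scoped BigOperators Topology
open Filter Set Metric
open Literature.MathematicalPhysics.StatisticalMechanics
open Summit.AtomisticToContinuum.Crystallization.Theorems.ChargedEnergyGapNegative (E3)

/-! ## §29 The finite-certificate reduction with parameters -/

/-- **`LOCAL(δ, r, Λ)` from a finite certificate, abstract tail.** Let `δ > 0`, `r ≥ 0`, `R' ≥ 0`
and let `τ` be a lower truncation allowance at radius `R'` for `δ`-separated sets.  If every finite
`δ`-separated half-space cluster `F ∋ 0` within `r + R'` of `0` has a site `p`, `dist p 0 ≤ r`, whose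
truncated cluster sum exceeds `Λ + τ`, then no `δ`-separated `Y ∋ 0` in a closed half-space through
`0` has all its sites within `r` of `0` bound `≤ Λ` (as in part XII: `F = Y ∩ closedBall 0 (r + R')`,
and the near set of the certified site in `Y` is its near set in `F`). [folklore] -/
theorem local_of_finiteCert_of_tail_at {δ r Λ R' τ : ℝ} (hδ : 0 < δ) (hr : 0 ≤ r) (hR' : 0 ≤ R')
    (htail : ∀ Y : Set E3, (∀ a ∈ Y, ∀ b ∈ Y, a ≠ b → δ ≤ dist a b) →
      ∀ (p : E3) (N : Finset E3), (∀ q, q ∈ N ↔ q ∈ Y ∧ q ≠ p ∧ dist q p ≤ R') →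
        ∑ q ∈ N, lennardJones (dist p q) - τ ≤
          ∑' q : {q : E3 // q ∈ Y ∧ q ≠ p}, lennardJones (dist p q.1))
    (hcert : ∀ (F : Finset E3) (u : E3), ‖u‖ = 1 → (0 : E3) ∈ F →
      (∀ a ∈ F, ∀ b ∈ F, a ≠ b → δ ≤ dist a b) → (∀ a ∈ F, inner ℝ a u ≤ 0) →
      (∀ a ∈ F, dist a 0 ≤ r + R') →
      ∃ p ∈ F, dist p 0 ≤ r ∧ ∀ N : Finset E3,
        (∀ q, q ∈ N ↔ q ∈ F ∧ q ≠ p ∧ dist q p ≤ R') →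
          Λ + τ < ∑ q ∈ N, lennardJones (dist p q))
    (Y : Set E3) (u : E3) (hu : ‖u‖ = 1) (h0 : (0 : E3) ∈ Y)
    (hsep : ∀ p ∈ Y, ∀ q ∈ Y, p ≠ q → δ ≤ dist p q) (hhalf : ∀ q ∈ Y, inner ℝ q u ≤ 0)
    (hU : ∀ p ∈ Y, dist p 0 ≤ r →
      ∑' q : {q : E3 // q ∈ Y ∧ q ≠ p}, lennardJones (dist p q.1) ≤ Λ) :
    False := by
  -- the finite cluster `F = Y ∩ closedBall 0 (r + R')`
  have hfin := finite_sep_ball hδ hsep (0 : E3) (r + R')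
  set F : Finset E3 := hfin.toFinset with hFdef
  have hF : ∀ z, z ∈ F ↔ z ∈ Y ∧ dist z 0 ≤ r + R' := fun z => by
    rw [hFdef, Set.Finite.mem_toFinset]; rfl
  have h0F : (0 : E3) ∈ F := (hF 0).2 ⟨h0, by rw [dist_self]; linarith⟩
  obtain ⟨p, hpF, hpr, hcertp⟩ := hcert F u hu h0F
    (fun a ha b hb hab => hsep a ((hF a).1 ha).1 b ((hF b).1 hb).1 hab)
    (fun a ha => hhalf a ((hF a).1 ha).1) (fun a ha => ((hF a).1 ha).2)
  have hp : p ∈ Y := ((hF p).1 hpF).1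
  -- the near set of `p` in `Y` is its near set in `F`
  obtain ⟨N, hN⟩ := exists_finset_near hδ hsep p R'
  have hN' : ∀ q, q ∈ N ↔ q ∈ F ∧ q ≠ p ∧ dist q p ≤ R' := by
    intro q
    rw [hN, hF]
    constructor
    · rintro ⟨hq, hqp, hd⟩
      exact ⟨⟨hq, by linarith [dist_triangle q p 0]⟩, hqp, hd⟩
    · rintro ⟨⟨hq, -⟩, hqp, hd⟩
      exact ⟨hq, hqp, hd⟩
  have h1 := htail Y hsep p N hN
  have h2 := hcertp N hN'
  have h3 := hU p hp hpr
  linarith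

/-- **Sub-goal `stub_local_of_finiteCert_at` of the stub `stub_localHalfSpaceCert`** (registered on
stmt-AtomisticToContinuum-15099): for every separation `δ > 0`, constraint radius `r ≥ 0`, level `Λ`
and truncation radius `R' > 0`, `FINCERT(δ, r, Λ, R') → LOCAL(δ, r, Λ)` with the sharp allowance
`T(δ, R')/6 = (16/(δ³R'³) + 18/(δ²R'⁴) + 36/(5δR'⁵) + 1/R'⁶)/6` of part XIV
(`local_of_finiteCert_of_tail_at` with `sum_near_sub_sharpTail_le_tsum`). [folklore] -/
theorem stub_local_of_finiteCert_at :
    ∀ (δ r Λ R' : ℝ), 0 < δ → 0 ≤ r → 0 < R' →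
      (∀ (F : Finset (EuclideanSpace ℝ (Fin 3))) (u : EuclideanSpace ℝ (Fin 3)), ‖u‖ = 1 →
        (0 : EuclideanSpace ℝ (Fin 3)) ∈ F →
        (∀ a ∈ F, ∀ b ∈ F, a ≠ b → δ ≤ dist a b) →
        (∀ a ∈ F, inner ℝ a u ≤ 0) →
        (∀ a ∈ F, dist a 0 ≤ r + R') →
        ∃ p ∈ F, dist p 0 ≤ r ∧
          ∀ N : Finset (EuclideanSpace ℝ (Fin 3)),
            (∀ q, q ∈ N ↔ q ∈ F ∧ q ≠ p ∧ dist q p ≤ R') →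
            Λ + 1 / 6 * (16 / (δ ^ 3 * R' ^ 3) + 18 / (δ ^ 2 * R' ^ 4) +
                36 / (5 * δ * R' ^ 5) + 1 / R' ^ 6) <
              ∑ q ∈ N, lennardJones (dist p q)) →
      ∀ (Y : Set (EuclideanSpace ℝ (Fin 3))) (u : EuclideanSpace ℝ (Fin 3)), ‖u‖ = 1 →
        (0 : EuclideanSpace ℝ (Fin 3)) ∈ Y →
        (∀ p ∈ Y, ∀ q ∈ Y, p ≠ q → δ ≤ dist p q) →
        (∀ q ∈ Y, inner ℝ q u ≤ 0) →
        (∀ p ∈ Y, dist p 0 ≤ r → ∑' q : {q : EuclideanSpace ℝ (Fin 3) // q ∈ Y ∧ q ≠ p},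
            lennardJones (dist p q.1) ≤ Λ) →
        False := by
  intro δ r Λ R' hδ hr hR' hcert Y u hu h0 hsep hhalf hU
  exact local_of_finiteCert_of_tail_at
    (τ := 1 / 6 * (16 / (δ ^ 3 * R' ^ 3) + 18 / (δ ^ 2 * R' ^ 4) + 36 / (5 * δ * R' ^ 5) +
      1 / R' ^ 6))
    hδ hr hR'.le (fun Y' hsep' p N hN => sum_near_sub_sharpTail_le_tsum hδ hsep' p hR' N hN)
    hcert Y u hu h0 hsep hhalf hU

/-- **The reshaped `(LOCAL♯)` from its finite certificate.** The instance
`(δ, r, Λ) = (23/40, 6, −711/500)` of `stub_local_of_finiteCert_at`: `(∃ R' > 0, FINCERT♯) → (LOCAL♯)`,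
where `(LOCAL♯)` is `(LOCAL)` posed at separation `23/40` (legitimate by part XV). [folklore] -/
theorem local_sharpSep_of_finiteCert
    (H : ∃ R' : ℝ, 0 < R' ∧
      ∀ (F : Finset (EuclideanSpace ℝ (Fin 3))) (u : EuclideanSpace ℝ (Fin 3)), ‖u‖ = 1 →
        (0 : EuclideanSpace ℝ (Fin 3)) ∈ F →
        (∀ a ∈ F, ∀ b ∈ F, a ≠ b → 23 / 40 ≤ dist a b) →
        (∀ a ∈ F, inner ℝ a u ≤ 0) →
        (∀ a ∈ F, dist a 0 ≤ 6 + R') →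
        ∃ p ∈ F, dist p 0 ≤ 6 ∧
          ∀ N : Finset (EuclideanSpace ℝ (Fin 3)),
            (∀ q, q ∈ N ↔ q ∈ F ∧ q ≠ p ∧ dist q p ≤ R') →
            -(711 / 500) + 1 / 6 * (16 / ((23 / 40) ^ 3 * R' ^ 3) + 18 / ((23 / 40) ^ 2 * R' ^ 4) +
                36 / (5 * (23 / 40) * R' ^ 5) + 1 / R' ^ 6) <
              ∑ q ∈ N, lennardJones (dist p q)) :
    ∀ (Y : Set (EuclideanSpace ℝ (Fin 3))) (u : EuclideanSpace ℝ (Fin 3)), ‖u‖ = 1 →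
      (0 : EuclideanSpace ℝ (Fin 3)) ∈ Y →
      (∀ p ∈ Y, ∀ q ∈ Y, p ≠ q → 23 / 40 ≤ dist p q) →
      (∀ q ∈ Y, inner ℝ q u ≤ 0) →
      (∀ p ∈ Y, dist p 0 ≤ 6 → ∑' q : {q : EuclideanSpace ℝ (Fin 3) // q ∈ Y ∧ q ≠ p},
          lennardJones (dist p q.1) ≤ -(711 / 500)) →
      False := by
  obtain ⟨R', hR', hcert⟩ := H
  exact stub_local_of_finiteCert_at (23 / 40) 6 (-(711 / 500)) R' (by norm_num) (by norm_num)
    hR' hcert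

/-- **`(CORE)` from `(LOCAL♯)`.** If `(LOCAL)` holds at separation `23/40` (no `23/40`-separated
half-space configuration through `0` has all its sites within `6` of `0` bound `≤ −711/500`), then
the half-space core `(CORE)` of the skeleton holds: a `1/4`-separated thick half-space configuration
through `0` with all site sums `≤ −711/500` is `23/40`-separated by `sep_of_quarter_sharp`
(`(SEP)` then part XV), and `(LOCAL♯)` applies (thickness is not used). [folklore] -/
theorem halfSpaceCore_of_localSharp
    (H : ∀ (Y : Set (EuclideanSpace ℝ (Fin 3))) (u : EuclideanSpace ℝ (Fin 3)), ‖u‖ = 1 →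
      (0 : EuclideanSpace ℝ (Fin 3)) ∈ Y →
      (∀ p ∈ Y, ∀ q ∈ Y, p ≠ q → 23 / 40 ≤ dist p q) →
      (∀ q ∈ Y, inner ℝ q u ≤ 0) →
      (∀ p ∈ Y, dist p 0 ≤ 6 → ∑' q : {q : EuclideanSpace ℝ (Fin 3) // q ∈ Y ∧ q ≠ p},
          lennardJones (dist p q.1) ≤ -(711 / 500)) →
      False) :
    ∀ (Y : Set (EuclideanSpace ℝ (Fin 3))) (u : EuclideanSpace ℝ (Fin 3)), ‖u‖ = 1 →
      (0 : EuclideanSpace ℝ (Fin 3)) ∈ Y →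
      (∀ p ∈ Y, ∀ q ∈ Y, p ≠ q → 1 / 4 ≤ dist p q) →
      (∀ q ∈ Y, inner ℝ q u ≤ 0) →
      (∀ t : ℝ, ∃ q ∈ Y, inner ℝ q u < -t) →
      (∀ p ∈ Y, ∑' q : {q : EuclideanSpace ℝ (Fin 3) // q ∈ Y ∧ q ≠ p},
          lennardJones (dist p q.1) ≤ -(711 / 500)) →
      False :=
  fun Y u hu h0 hsep hhalf _ hU =>
    H Y u hu h0 (sep_of_quarter_sharp hsep hU) hhalf fun p hp _ => hU p hp

end Summit.AtomisticToContinuum.Crystallization.Theorems.PerronTransitivityUniformBindingRigidity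

end
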